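import Literature.NumberTheory.Automorphic.UnitaryGroupAutomorphicRep
import Literature.NumberTheory.GaloisRepresentations.HeckeCharacter
import HarnessLib

/-!
# The Siegel parabolic of `U(m, m)`, Siegel sections, and the Siegel–hermitian Eisenstein series

Topic `NumberTheory/K2Lit` (Track B build stream 29, leaf D2 of the in-house road for
Liu 2021, Thm. B.4 (1): planner `hodgecm-mathlib-K2Liu-plan`, squad memo
`K2/K2Liu-plan/g0/DEPMAP-PRICE-184nat.v1.K2Liu-plan-g0.md` §5). Definitions and proved lemmas only:
**no `sorry`, no named fact, no instance, no notation.**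

**Setting.** `E/F` number fields with `c : E ≃ₐ[F] E`, `m : ℕ`, and the SPLIT hermitian form of
rank `2m`, `J_{m,m} = (0 1_m; 1_m 0)` on `E^{m+m}` (indices `Fin (m + m)`, blocks read through
`finSumFinEquiv : Fin m ⊕ Fin m ≃ Fin (m + m)`). The unitary group `U(m, m) = U(J_{m,m})` is the
tree's `UnitaryGroup.rational/adelic F E c (m + m) (splitForm E m)` (★ `UnitaryGroupAutomorphicRep`).
For the doubling method (Liu 2021 §B.3; Tan 1999 §1) one needs:

* `K2Lit.SiegelUnitary.ul/ur/ll/lr` — the four `m × m` blocks of a `(m+m) × (m+m)` matrix, with the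
  block-multiplication lemmas `ll_mul`, `ul_mul` and `ul_one`, `ll_one`;
* `K2Lit.SiegelUnitary.siegelOf G` — for ANY subgroup `G ≤ GL_{m+m}(R)`, the **Siegel subgroup**
  `P_G = {g ∈ G | g₂₁ = 0 and (g⁻¹)₂₁ = 0}` (for invertible block matrices the second condition
  follows from the first; carrying it makes `P_G` a subgroup with no determinant argument) — the
  stabiliser in `G` of the Lagrangian `V⁺ = ⟨e_1, …, e_m⟩` of `J_{m,m}`;
* `K2Lit.SiegelUnitary.leviDet : P_G →* Rˣ` — `p ↦ det(p₁₁)`, a unit since `p₁₁ (p⁻¹)₁₁ = 1`;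
* over the adeles: `siegelAdelic`, the **modulus-type character**
  `siegelCharacter χ s p = χ(det p₁₁) · ‖det p₁₁‖_{𝔸_E}^{s + m/2}` (`χ` a Hecke character of `E`,
  Tan's/Liu's normalisation `I(s, χ) = Ind_P^G (χ |·|_E^s) ∘ det`, `ρ_P ↔ m/2`), the predicate
  `IsSiegelSection χ s f` (`f(pg) = siegelCharacter χ s p · f(g)` on `U(m,m)(𝔸_F)`), and
* the **Siegel–hermitian Eisenstein series** `eisensteinSeries f g = ∑' over P(F)\U(m,m)(F) of
  f(γ g)`, the sum running over the quotient of `U(m,m)(F)` by LEFT multiplication of `P(F)`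
  (`MulAction.orbitRel`), each class evaluated at `Quotient.out` (independence of the representative
  for Siegel sections — `χ` trivial on `E×`, product formula — and absolute convergence for
  `Re s > m/2` are the planned files `K2LiuSiegelEisensteinAutomorphy` / `…Convergence`, not here;
  `tsum` returns `0` off the domain of summability, the usual junk-value convention). Pole notions
  («`E` has a pole at `s₀`», Liu Thm. B.4 (1)(b)) are NOT defined here: they need STANDARD
  (`K`-flat, holomorphic) sections — over arbitrary section families «unbounded near `s₀`» would be
  vacuously true — and wait for the standard-section leaf.

References: V. Tan, *Poles of Siegel Eisenstein series on U(n,n)*, Canad. J. Math. 51 (1999) §1;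
Y. Liu, *Fourier–Jacobi cycles and arithmetic relative trace formula*, Invent. Math. 228 (2022),
App. B §B.3, p. 101 («the space of degenerate principal series J_a(s, μᶜ) as the normalized induced
representation … the Siegel–hermitian Eisenstein series E_{P_a}(·; f_{a,s}) … absolutely convergent for
Re(s) > (n+a)/2»).
-/

noncomputable section

open scoped Matrix
open NumberField IsDedekindDomain

namespace Literature.NumberTheory.K2Lit.SiegelUnitary

open Literature.NumberTheory.Automorphic Literature.NumberTheory.GaloisRepresentations

/-! ## 1. Blocks of an `(m+m) × (m+m)` matrix -/

section Blocks

variable {R : Type*} [CommRing R] (m : ℕ)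

/-- A matrix on `Fin (m+m)` re-read on `Fin m ⊕ Fin m` through `finSumFinEquiv`. [folklore] -/
def blk (g : Matrix (Fin (m + m)) (Fin (m + m)) R) : Matrix (Fin m ⊕ Fin m) (Fin m ⊕ Fin m) R :=
  g.submatrix finSumFinEquiv finSumFinEquiv

/-- Upper-left `m × m` block `g₁₁`. [folklore] -/
def ul (g : Matrix (Fin (m + m)) (Fin (m + m)) R) : Matrix (Fin m) (Fin m) R := (blk m g).toBlocks₁₁
/-- Upper-right block `g₁₂`. [folklore] -/
def ur (g : Matrix (Fin (m + m)) (Fin (m + m)) R) : Matrix (Fin m) (Fin m) R := (blk m g).toBlocks₁₂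
/-- Lower-left block `g₂₁`. [folklore] -/
def ll (g : Matrix (Fin (m + m)) (Fin (m + m)) R) : Matrix (Fin m) (Fin m) R := (blk m g).toBlocks₂₁
/-- Lower-right block `g₂₂`. [folklore] -/
def lr (g : Matrix (Fin (m + m)) (Fin (m + m)) R) : Matrix (Fin m) (Fin m) R := (blk m g).toBlocks₂₂

/-- Re-reading on `Fin m ⊕ Fin m` is multiplicative (block calculus `g = (a b; c d)` of Tan 1999 §1). [cite: Tan1999, §1] -/
theorem blk_mul (g h : Matrix (Fin (m + m)) (Fin (m + m)) R) : blk m (g * h) = blk m g * blk m h := by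
  unfold blk
  exact (Matrix.submatrix_mul_equiv g h _ finSumFinEquiv _).symm

/-- Re-reading on `Fin m ⊕ Fin m` sends `1` to `1`. [cite: Tan1999, §1] -/
theorem blk_one : blk m (1 : Matrix (Fin (m + m)) (Fin (m + m)) R) = 1 := by
  unfold blk
  exact Matrix.submatrix_one_equiv _

omit [CommRing R] in
/-- `g = (g₁₁ g₁₂; g₂₁ g₂₂)` (Tan 1999 §1, `g = (a b; c d)`). [cite: Tan1999, §1] -/
theorem blk_eq_fromBlocks (g : Matrix (Fin (m + m)) (Fin (m + m)) R) :
    blk m g = Matrix.fromBlocks (ul m g) (ur m g) (ll m g) (lr m g) := by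
  unfold ul ur ll lr
  exact (Matrix.fromBlocks_toBlocks _).symm

/-- Block multiplication, lower-left entry: `(gh)₂₁ = g₂₁ h₁₁ + g₂₂ h₂₁`. [cite: Tan1999, §1] -/
theorem ll_mul (g h : Matrix (Fin (m + m)) (Fin (m + m)) R) :
    ll m (g * h) = ll m g * ul m h + lr m g * ll m h := by
  have hmul := blk_mul m g h
  rw [blk_eq_fromBlocks m g, blk_eq_fromBlocks m h, Matrix.fromBlocks_multiply] at hmul
  have := congrArg Matrix.toBlocks₂₁ hmul
  simpa [ll, Matrix.toBlocks_fromBlocks₂₁] using this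

/-- Block multiplication, upper-left entry: `(gh)₁₁ = g₁₁ h₁₁ + g₁₂ h₂₁`. [cite: Tan1999, §1] -/
theorem ul_mul (g h : Matrix (Fin (m + m)) (Fin (m + m)) R) :
    ul m (g * h) = ul m g * ul m h + ur m g * ll m h := by
  have hmul := blk_mul m g h
  rw [blk_eq_fromBlocks m g, blk_eq_fromBlocks m h, Matrix.fromBlocks_multiply] at hmul
  have := congrArg Matrix.toBlocks₁₁ hmul
  simpa [ul, Matrix.toBlocks_fromBlocks₁₁] using this

/-- `1₁₁ = 1`. [cite: Tan1999, §1] -/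
theorem ul_one : ul m (1 : Matrix (Fin (m + m)) (Fin (m + m)) R) = 1 := by
  ext i j
  simp [ul, blk_one, Matrix.toBlocks₁₁, Matrix.one_apply]

/-- `1₂₁ = 0`. [cite: Tan1999, §1] -/
theorem ll_one : ll m (1 : Matrix (Fin (m + m)) (Fin (m + m)) R) = 0 := by
  ext i j
  simp [ll, blk_one, Matrix.toBlocks₂₁]

/-! ## 2. The Siegel subgroup of a subgroup of `GL_{m+m}(R)` and its Levi determinant -/

/-- **The Siegel subgroup** `P_G = {g ∈ G | g₂₁ = 0, (g⁻¹)₂₁ = 0}` of a subgroup `G ≤ GL_{m+m}(R)`: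
the stabiliser in `G` of `V⁺ = ⟨e_1, …, e_m⟩` (Liu 2021 §B.3: «P_a … the parabolic subgroup of
U(V_a^◇) stabilizing the maximal totally isotropic subspace V_a^+»). [cite: Liu2021, §B.3 p. 101] -/
def siegelOf (G : Subgroup (GL (Fin (m + m)) R)) : Subgroup (GL (Fin (m + m)) R) where
  carrier := {g | g ∈ G ∧ ll m (g : Matrix (Fin (m + m)) (Fin (m + m)) R) = 0 ∧
    ll m ((g⁻¹ : GL (Fin (m + m)) R) : Matrix (Fin (m + m)) (Fin (m + m)) R) = 0}
  one_mem' := by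
    refine ⟨G.one_mem, ?_, ?_⟩
    · simp [ll_one]
    · simp [ll_one]
  mul_mem' {g h} hg hh := by
    refine ⟨G.mul_mem hg.1 hh.1, ?_, ?_⟩
    · rw [Units.val_mul, ll_mul, hg.2.1, hh.2.1]; simp
    · rw [mul_inv_rev, Units.val_mul, ll_mul, hh.2.2, hg.2.2]; simp
  inv_mem' {g} hg := by
    refine ⟨G.inv_mem hg.1, hg.2.2, ?_⟩
    rw [inv_inv]; exact hg.2.1

/-- Membership in the Siegel subgroup. [cite: Liu2021, §B.3 p. 101] -/
theorem mem_siegelOf_iff {G : Subgroup (GL (Fin (m + m)) R)} {g : GL (Fin (m + m)) R} :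
    g ∈ siegelOf m G ↔ g ∈ G ∧ ll m (g : Matrix (Fin (m + m)) (Fin (m + m)) R) = 0 ∧
      ll m ((g⁻¹ : GL (Fin (m + m)) R) : Matrix (Fin (m + m)) (Fin (m + m)) R) = 0 :=
  Iff.rfl

/-- The Siegel subgroup of `G` lies in `G`. [cite: Liu2021, §B.3 p. 101] -/
theorem siegelOf_le (G : Subgroup (GL (Fin (m + m)) R)) : siegelOf m G ≤ G := fun _ hg => hg.1

/-- For `p` in the Siegel subgroup, `p₁₁ · (p⁻¹)₁₁ = 1`. [cite: Tan1999, §1] -/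
theorem ul_mul_ul_inv {G : Subgroup (GL (Fin (m + m)) R)} (p : siegelOf m G) :
    ul m (p.1 : Matrix (Fin (m + m)) (Fin (m + m)) R) *
      ul m ((p.1⁻¹ : GL (Fin (m + m)) R) : Matrix (Fin (m + m)) (Fin (m + m)) R) = 1 := by
  have h := ul_mul m (p.1 : Matrix (Fin (m + m)) (Fin (m + m)) R)
    ((p.1⁻¹ : GL (Fin (m + m)) R) : Matrix (Fin (m + m)) (Fin (m + m)) R)
  rw [p.2.2.2, Matrix.mul_zero, add_zero, ← Units.val_mul, mul_inv_cancel, Units.val_one, ul_one] at h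
  exact h.symm

/-- For `p` in the Siegel subgroup, `(p⁻¹)₁₁ · p₁₁ = 1`. [cite: Tan1999, §1] -/
theorem ul_inv_mul_ul {G : Subgroup (GL (Fin (m + m)) R)} (p : siegelOf m G) :
    ul m ((p.1⁻¹ : GL (Fin (m + m)) R) : Matrix (Fin (m + m)) (Fin (m + m)) R) *
      ul m (p.1 : Matrix (Fin (m + m)) (Fin (m + m)) R) = 1 := by
  have h := ul_mul_ul_inv m p⁻¹
  simpa using h

/-- For `p, q` in the Siegel subgroup, `(pq)₁₁ = p₁₁ q₁₁`. [cite: Tan1999, §1] -/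
theorem ul_mul_of_mem {G : Subgroup (GL (Fin (m + m)) R)} (p q : siegelOf m G) :
    ul m ((p * q).1 : Matrix (Fin (m + m)) (Fin (m + m)) R) =
      ul m (p.1 : Matrix (Fin (m + m)) (Fin (m + m)) R) * ul m (q.1 : Matrix (Fin (m + m)) (Fin (m + m)) R) := by
  rw [Subgroup.coe_mul, Units.val_mul, ul_mul, q.2.2.1, Matrix.mul_zero, add_zero]

/-- **The Levi determinant** `P_G →* Rˣ`, `p ↦ det p₁₁` (the `det` of the `GL_m`-part of the Levi
quotient `Res GL_m` of the Siegel parabolic; Liu 2021 §B.3 «the Levi quotient of P_a is isomorphic to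
Res_{E/F} GL_{n+a}»). [cite: Liu2021, §B.3 p. 101] -/
def leviDet (G : Subgroup (GL (Fin (m + m)) R)) : siegelOf m G →* Rˣ where
  toFun p :=
    { val := (ul m (p.1 : Matrix (Fin (m + m)) (Fin (m + m)) R)).det
      inv := (ul m ((p.1⁻¹ : GL (Fin (m + m)) R) : Matrix (Fin (m + m)) (Fin (m + m)) R)).det
      val_inv := by rw [← Matrix.det_mul, ul_mul_ul_inv, Matrix.det_one]
      inv_val := by rw [← Matrix.det_mul, ul_inv_mul_ul, Matrix.det_one] }
  map_one' := by
    ext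
    simp [ul_one]
  map_mul' p q := by
    ext
    simp only [Units.val_mul]
    rw [ul_mul_of_mem, Matrix.det_mul]

/-- `leviDet p = det p₁₁` as an element of `R`. [cite: Liu2021, §B.3 p. 101] -/
@[simp] theorem val_leviDet_apply {G : Subgroup (GL (Fin (m + m)) R)} (p : siegelOf m G) :
    ((leviDet m G p : Rˣ) : R) = (ul m (p.1 : Matrix (Fin (m + m)) (Fin (m + m)) R)).det := rfl

end Blocks

/-! ## 3. `U(m, m)`: the split form, adelic and rational Siegel subgroups, sections, Eisenstein series -/

section Global

variable (F E : Type) [Field F] [NumberField F] [Field E] [NumberField E] [Algebra F E]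
  (c : E ≃ₐ[F] E) (m : ℕ)

/-- **The split hermitian form `J_{m,m} = (0 1; 1 0)` of rank `2m`** over `E` (entries in `F`, so
`(J.map c)ᵀ = J`): `U(J_{m,m}) = U(m, m)` is quasi-split with Lagrangian `V⁺ = ⟨e_1, …, e_m⟩`
(Tan 1999 §1; Liu 2021 §B.3, `V_a^◇ ≅ (E^{2(n+a)}, J)`). [cite: Tan1999, §1] -/
def splitForm : Matrix (Fin (m + m)) (Fin (m + m)) E :=
  (Matrix.fromBlocks (0 : Matrix (Fin m) (Fin m) E) 1 1 0).submatrix finSumFinEquiv.symm finSumFinEquiv.symm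

omit [NumberField E] in
/-- Read on `Fin m ⊕ Fin m`, the split form is the block matrix `(0 1; 1 0)`. [cite: Tan1999, §1] -/
theorem blk_splitForm : blk m (splitForm E m) = Matrix.fromBlocks (0 : Matrix (Fin m) (Fin m) E) 1 1 0 := by
  ext i j
  simp [blk, splitForm]

omit [NumberField F] [NumberField E] in
/-- The split form is `c`-hermitian: `(J.map c)ᵀ = J` (its entries are `0`, `1`). [cite: Tan1999, §1] -/
theorem splitForm_map_transpose : ((splitForm E m).map (c : E →+* E))ᵀ = splitForm E m := by
  ext i j
  simp only [splitForm, Matrix.transpose_apply, Matrix.map_apply, Matrix.submatrix_apply]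
  rcases hi : finSumFinEquiv.symm i with i' | i' <;> rcases hj : finSumFinEquiv.symm j with j' | j' <;>
    simp [Matrix.fromBlocks, Matrix.one_apply, eq_comm, apply_ite (c : E →+* E)]

/-- `U(m,m)(𝔸_F) ≤ GL_{2m}(𝔸_E)` (the tree's adelic unitary group of `J_{m,m}`). [cite: Tan1999, §1] -/
abbrev adelicGroup : Subgroup (GL (Fin (m + m)) (AdeleRing (𝓞 E) E)) :=
  UnitaryGroup.adelic F E c (m + m) (splitForm E m)

/-- `U(m,m)(F) ≤ GL_{2m}(E)`. [cite: Tan1999, §1] -/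
abbrev rationalGroup : Subgroup (GL (Fin (m + m)) E) :=
  UnitaryGroup.rational F E c (m + m) (splitForm E m)

/-- **The adelic Siegel parabolic** `P(𝔸_F) ≤ U(m,m)(𝔸_F)`. [cite: Liu2021, §B.3 p. 101] -/
def siegelAdelic : Subgroup (GL (Fin (m + m)) (AdeleRing (𝓞 E) E)) := siegelOf m (adelicGroup F E c m)

/-- **The rational Siegel parabolic** `P(F) ≤ U(m,m)(F)`. [cite: Liu2021, §B.3 p. 101] -/
def siegelRational : Subgroup (GL (Fin (m + m)) E) := siegelOf m (rationalGroup F E c m)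

/-- `P(F)` as a subgroup of the group `U(m,m)(F)` (for the quotient `P(F) \ U(m,m)(F)`). [folklore] -/
def siegelRationalIn : Subgroup (rationalGroup F E c m) := (siegelRational F E c m).subgroupOf _

/-- **The character `p ↦ χ(det p₁₁) ‖det p₁₁‖^{s + m/2}` of `P(𝔸_F)`** defining the degenerate
principal series `I(s, χ) = Ind_{P(𝔸)}^{U(m,m)(𝔸)} (χ |·|_E^s ∘ det)` in the unitary normalisation
(`Re s = 0` unitary axis; `ρ_P = m/2` in the exponent of `|det|_E`) — Tan 1999 §1, Liu 2021 §B.3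
(«J_a(s, μᶜ) as the normalized induced representation Ind (μᶜ · |·|^s) ∘ det_{n+a}»).
[cite: Tan1999, §1] [cite: Liu2021, §B.3 p. 101] -/
def siegelCharacter (χ : HeckeCharacter E) (s : ℂ) (p : siegelAdelic F E c m) : ℂ :=
  ((χ (leviDet m (adelicGroup F E c m) p) : ℂˣ) : ℂ) *
    ((ideleNorm (leviDet m (adelicGroup F E c m) p) : ℂ) ^ (s + (m : ℂ) / 2))

/-- **Siegel sections**: `f : GL_{2m}(𝔸_E) → ℂ` (read on `U(m,m)(𝔸_F)`) lies in `I(s, χ)` when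
`f(p g) = χ(det p₁₁) ‖det p₁₁‖^{s+m/2} f(g)` for `p ∈ P(𝔸_F)`, `g ∈ U(m,m)(𝔸_F)` (smoothness and
`K`-finiteness are added by the standard-section leaf). [cite: Tan1999, §1] -/
def IsSiegelSection (χ : HeckeCharacter E) (s : ℂ) (f : GL (Fin (m + m)) (AdeleRing (𝓞 E) E) → ℂ) : Prop :=
  ∀ p : siegelAdelic F E c m, ∀ g ∈ adelicGroup F E c m,
    f ((p.1 : GL (Fin (m + m)) (AdeleRing (𝓞 E) E)) * g) = siegelCharacter F E c m χ s p * f g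

/-- A family `s ↦ f_s` of Siegel sections (a «section of `I(s, χ)`» in the sense of Tan 1999 §1 /
Liu 2021 Lem. B.10, before holomorphy and standardness are imposed). [cite: Tan1999, §1] -/
def IsSiegelSectionFamily (χ : HeckeCharacter E) (f : ℂ → GL (Fin (m + m)) (AdeleRing (𝓞 E) E) → ℂ) : Prop :=
  ∀ s : ℂ, IsSiegelSection F E c m χ s (f s)

/-- The quotient `P(F) \ U(m,m)(F)` (orbits of `P(F)` acting on `U(m,m)(F)` by left multiplication).
[folklore] -/
def SiegelQuot : Type := Quotient (MulAction.orbitRel (siegelRationalIn F E c m) (rationalGroup F E c m))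

/-- **The Siegel–hermitian Eisenstein series** `E(g; f) = Σ_{γ ∈ P(F)\U(m,m)(F)} f(γ g)` (Tan 1999
§1; Liu 2021 §B.3 «the Siegel–hermitian Eisenstein series E_{P_a}(·; f_{a,s}) … absolutely convergent
for Re(s) > (n+a)/2»): the `tsum` over the coset space, each coset evaluated at a chosen representative
(`Quotient.out`); for a Siegel section the summand does not depend on the choice (planned lemma), and
the series converges absolutely for `Re s > m/2` (planned lemma); elsewhere `tsum`'s junk value `0`.
[cite: Tan1999, §1] [cite: Liu2021, Lem. B.10 (2) p. 102] -/
def eisensteinSeries (f : GL (Fin (m + m)) (AdeleRing (𝓞 E) E) → ℂ)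
    (g : GL (Fin (m + m)) (AdeleRing (𝓞 E) E)) : ℂ :=
  ∑' q : SiegelQuot F E c m,
    f ((UnitaryGroup.toAdelic F E c (m + m) (splitForm E m) (Quotient.out q) :
        GL (Fin (m + m)) (AdeleRing (𝓞 E) E)) * g)

/-- The Eisenstein series attached to a family of sections, `E(g; f_s)`. [cite: Tan1999, §1] -/
def eisensteinFamily (f : ℂ → GL (Fin (m + m)) (AdeleRing (𝓞 E) E) → ℂ) (s : ℂ)
    (g : GL (Fin (m + m)) (AdeleRing (𝓞 E) E)) : ℂ :=
  eisensteinSeries F E c m (f s) g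

end Global

end Literature.NumberTheory.K2Lit.SiegelUnitary
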